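import Literature.Computability.Cryptography.CsidhActionKernelsProofs
import HarnessLib

/-!
# The CSIDH class-group action: every non-zero `m + n√-p ∈ ℤ[√-p]` is an `𝔽_p`-endomorphism of `E_A`

Sibling *proofs* file (theorems only, D-0014/D-0026) of
`Literature.Computability.Cryptography.CsidhAction`, working towards the named fact
`csidh_classGroupAction` (Castryck–Lange–Martindale–Panny–Renes, *CSIDH*, ASIACRYPT 2018, §3:
"principal ideals correspond to endomorphisms"; §4: `End_p(E_0) = ℤ[π]`). For a valid `A` and
`(m, n) ≠ (0, 0)` the map `T ↦ mT + n π(T)` on `E_A(𝔽̄_p)` is (the point map of) an `𝔽_p`-isogeny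
`E_A → E_A` in the sense of the tree (`exists_isogeny_re_im`): `[m]` (*AEC* III.4.1, the tree's
`Isogeny.zsmul`), `[n] ∘ π` (the tree's Frobenius isogeny), and their sum, which is an isogeny or
zero (*AEC* III.§4, the tree's `Isogeny.add_toAddMonoidHom_eq_zero_or_exists`) and is not zero:
`nπ = -m` on `E_A(𝔽̄_p)` gives, with `π² = -p`, `[m² + n²p] = 0`, whereas `E_A[m² + n²p]` is
finite and `E_A(𝔽̄_p)` is not.

## References

* [CastryckEtAl2018] W. Castryck, T. Lange, C. Martindale, L. Panny, J. Renes, *CSIDH*,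
  ASIACRYPT 2018, §3 (class-group action), §4.
* [SilvermanAEC2009] J. H. Silverman, *The Arithmetic of Elliptic Curves*, 2nd ed., III.§4
  (`Hom(E₁, E₂)` is a group; Example III.4.1), V.§2 (the Frobenius endomorphism).

## Design

`noncomputable section`, `open scoped Classical`; theorems only, no definitions, no new named
facts.
-/

noncomputable section

open scoped Classical

namespace Literature.Computability.Cryptography.Csidh

open WeierstrassCurve

variable {p : ℕ} [Fact p.Prime]

/-- For a valid `A`, no non-zero integer kills all of `E_A(𝔽̄_p)` (`E_A[N]` is finite, `E_A(𝔽̄_p)`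
is infinite). [cite: SilvermanAEC2009, Cor. III.6.4] -/
theorem exists_zsmul_ne_zero (hp8 : p % 8 = 3) {A : ZMod p} (hA : IsCoeff p A) {N : ℤ} (hN : N ≠ 0) :
    ∃ T : (curve p A).geomPoints, N • T ≠ 0 := by
  haveI := isElliptic_of_isCoeff hp8 hA
  by_contra h
  push Not at h
  haveI : Finite (geomTorsion (curve p A) N) :=
    finite_torsionPoints_holds (curve p A) (AlgebraicClosure (ZMod p)) hN
  have htop : (geomTorsion (curve p A) N : Set (curve p A).geomPoints) = Set.univ := by
    ext T
    simp only [SetLike.mem_coe, Set.mem_univ, iff_true]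
    exact (Submodule.mem_torsionBy_iff _ _).2 (h T)
  have hfin : (Set.univ : Set (curve p A).geomPoints).Finite := htop ▸ Set.toFinite _
  exact Set.infinite_univ (α := (curve p A).geomPoints) hfin

/-- **`[n] ∘ π` is an `𝔽_p`-isogeny** (`n ≠ 0`), acting by `T ↦ n πT`. [folklore] -/
theorem exists_isogeny_zsmul_frob (hp8 : p % 8 = 3) {A : ZMod p} (hA : IsCoeff p A) {n : ℤ}
    (hn : n ≠ 0) : ∃ ψ : (curve p A).Isogeny (curve p A), ∀ T, ψ T = n • (frob p • T) := by
  haveI := isElliptic_of_isCoeff hp8 hA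
  refine ⟨(Isogeny.zsmul (curve p A) n hn).comp
    ((curve p A).frobeniusIsogeny (σ := frob p) fun x ↦ frob_smul_eq_pow_card x), fun T ↦ ?_⟩
  rw [Isogeny.comp_apply, Isogeny.zsmul_apply, frobeniusIsogeny_apply]

/-- **Every non-zero `z = m + n√-p ∈ ℤ[√-p]` is an `𝔽_p`-isogeny `E_A → E_A` acting by
`T ↦ mT + n πT`** (valid `A`). CSIDH §3–4: `ℤ[π] ⊆ End_p(E_A)`, "principal ideals correspond to
endomorphisms". [cite: CastryckEtAl2018, §3 (class-group action) and §4] -/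
theorem exists_isogeny_re_im (hp8 : p % 8 = 3) {A : ZMod p} (hA : IsCoeff p A) {m n : ℤ}
    (h : m ≠ 0 ∨ n ≠ 0) :
    ∃ φ : (curve p A).Isogeny (curve p A), ∀ T, φ T = m • T + n • (frob p • T) := by
  haveI := isElliptic_of_isCoeff hp8 hA
  by_cases hn : n = 0
  · have hm : m ≠ 0 := h.resolve_right (not_not.mpr hn)
    exact ⟨Isogeny.zsmul (curve p A) m hm, fun T ↦ by rw [Isogeny.zsmul_apply, hn, zero_smul, add_zero]⟩
  by_cases hm : m = 0
  · obtain ⟨ψ, hψ⟩ := exists_isogeny_zsmul_frob hp8 hA hn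
    exact ⟨ψ, fun T ↦ by rw [hψ, hm, zero_smul, zero_add]⟩
  obtain ⟨ψ, hψ⟩ := exists_isogeny_zsmul_frob hp8 hA hn
  rcases (Isogeny.zsmul (curve p A) m hm).add_toAddMonoidHom_eq_zero_or_exists ψ with h0 | ⟨φ, hφ⟩
  · -- `nπ = -m`: then `(m² + n²p) T = 0` for all `T`
    exfalso
    have hrel : ∀ T : (curve p A).geomPoints, n • (frob p • T) = -(m • T) := fun T ↦ by
      have := DFunLike.congr_fun h0 T
      rw [AddMonoidHom.add_apply, AddMonoidHom.zero_apply, Isogeny.coe_toAddMonoidHom,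
        Isogeny.coe_toAddMonoidHom, Isogeny.zsmul_apply, hψ] at this
      exact eq_neg_of_add_eq_zero_right this
    obtain ⟨T, hT⟩ := exists_zsmul_ne_zero hp8 hA (N := m ^ 2 + n ^ 2 * p) (by positivity)
    apply hT
    have h1 := hrel T
    have h2 := hrel (frob p • T)
    rw [frob_smul_frob_smul hp8 hA, ← frob_smul_zsmul, smul_neg] at h2
    -- `h1 : n πT = -mT`, `h2 : n (-(pT)) = -π(mT) = -(m πT)`
    rw [frob_smul_zsmul] at h2
    generalize frob p • T = X at h1 h2
    linear_combination (norm := module) m • h1 - n • h2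
  · refine ⟨φ, fun T ↦ ?_⟩
    have := DFunLike.congr_fun hφ T
    rw [AddMonoidHom.add_apply, Isogeny.coe_toAddMonoidHom, Isogeny.coe_toAddMonoidHom,
      Isogeny.coe_toAddMonoidHom, Isogeny.zsmul_apply, hψ] at this
    exact this

end Literature.Computability.Cryptography.Csidh
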